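import Summits.HodgeConjecture.HodgeConjecture.Theorems.F0P3cStCharTSSubmersionDescent       -- ★ p852066 (F0P2-p01) D2♭: `exists_newtonData_submersion_addSubgroup`
import Summits.HodgeConjecture.HodgeConjecture.Theorems.F0P3cStCharTSNewtonCore              -- ★ p852029 (F0P2-p01) FILE 2′: `depth_chart_of_newtonData`
import Summits.HodgeConjecture.HodgeConjecture.Theorems.F0P3cStCharTSChevalleyDifferential    -- ★ p852073 (LH1-p03) D4a FILE 2: `sigma_*_of_mem`, `trace_*_theta`, `exists_mem_trace_zero_differential_eq_of_linearIndependent`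
import Literature.MeasureTheory.Group.AddSubmersionBound                                      -- (C0) p852100 (this seat): `exists_setLIntegral_fst_le_of_continuousAddEquiv`
import Literature.LinearAlgebra.Matrix.CubicChevalleyStrictDeriv                              -- p852099 (LH1-p03) D4a FILE 3 (H-strict): `hasStrictFDerivAt_trace_adjugate`, `hasStrictFDerivAt_det`
import Literature.LinearAlgebra.Matrix.CharpolyBlockPatterns                                 -- ★ `charpoly_fin_three_trace_adjugate`
import Literature.LinearAlgebra.Matrix.CubicCharpolyDiscrNonRegular                           -- ★ p852036 (F0P3-p02) (C): `discr_eq_of_charpoly_eq`, `charpoly_fin_three_trace_minors_det`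
import Literature.NumberTheory.GaloisRepresentations.LocalFieldFiniteExtension                -- ★ R1 frame: `nontriviallyNormedField` + `completeSpace_∕isUltrametricDist_nontriviallyNormedField`, topology `rfl`
import Literature.NumberTheory.GaloisRepresentations.LocalField                               -- ★ `IsNonarchimedeanLocalField.normAbs` (R2 integrands)
import Literature.Analysis.Calculus.UltrametricNewtonChart                                    -- ★ p851977 D1: ball filtrations on the subtype
import Mathlib.Analysis.Matrix.Normed
import Mathlib.Analysis.Calculus.FDeriv.Mul
import Mathlib.Analysis.Calculus.FDeriv.Prod
import Literature.NumberTheory.Automorphic.LocalFieldHaarBalls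
import HarnessLib

/-!
# F0 · P3c · line LH6 «StCharTS» — road «HC-D», brick D5(i) FILE C «REGULAR POINTS ON `↥𝔲₀`»: `|η|^{−1∕2}` is integrable near every REGULAR point of the
# trace-zero skew-hermitian Lie algebra, GIVEN the cusp integrability on the coefficient group `A`

Cell `pub/hodgecm-mathlib`, crux H413 = `stmt-HodgeConjecture-24833` (lane `--supports … --as helper`), route HCCMUnconditional; road «HC-D» (holder ∕ dealer
F0P2-p01 (g23); DEAL 2026-09-02T16:21:56Z, WORDS #6 16:31:58Z «R3♭»), seat F0P3-p04 (g18).  THEOREMS ONLY (no definition ∕ instance ∕ notation ∕ named fact ∕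
`sorry`); ★-only imports.  HONEST LABEL: count-neutral; HC_CM is proved only modulo the printed citations (hLiu418 = `stmt-HodgeConjecture-24832`,
h413 = `stmt-HodgeConjecture-24833`) until rung 0 closes.

## Frame (road rulings R1–R5, R3♭)
* R3 carriers: `K` a non-archimedean local field (`[Field K] [ValuativeRel K] [TopologicalSpace K] [IsNonarchimedeanLocalField K]`); `σ : K →+* K` an involution,
  `J` with `(J.map σ)ᵀ = J`, `IsUnit J.det`; `(2 : K) ≠ 0`; a skew unit `λ` (`σ λ = −λ`); the trace-zero Lie algebra as an ARBITRARY additive subgroup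
  `𝔲₀ ≤ M₃(K)` with `h𝔲₀ : X ∈ 𝔲₀ ↔ (X.map σ)ᵀ J + J X = 0 ∧ tr X = 0`; the coefficient group `A ≤ K × K` with `hA : (c, d) ∈ A ↔ σ c = c ∧ σ d = −d`; additive Haar
  measures `μ` on `↥𝔲₀`, `ν` on `↥A` (Borel); closedness letters `IsClosed ↑𝔲₀`, `IsClosed ↑A` (they give `ProperSpace ↥𝔲₀` and
  local compactness of `↥A` without assuming `σ` continuous).  No scalar field structure on `↥𝔲₀` (R3♭ «there is no `F`»).
* R1: norms (elementwise sup on `M₃(K)`, the valuation norm `IsNonarchimedeanLocalField.nontriviallyNormedField K`) appear INSIDE the proof only; the head is instance-free.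
* R2 integrands in `normAbs K` as `ℝ≥0∞` inverses: `ηι X = (↑(√(√(|discr (charpoly X)|_K))))⁻¹`; on the coefficient side `δι (c, d) = (↑(√(√(|−4c³ − 27d²|_K))))⁻¹`;
  for trace-zero `X`, `discr (charpoly X) = −4 (tr adj X)³ − 27 (det X)²` (★ (C) `discr_eq_of_charpoly_eq` + `charpoly_fin_three_trace_minors_det`), so `ηι X = δι (tr adj X, det X)`.
* R5 regularity: `LinearIndependent K ![1, X₀, X₀²]`.

## Statement (`exists_nhds_setLIntegral_etaIota_lt_top`)
Under the frame, ASSUMING the cusp integrability on `↥A` («`hcusp`»: every point of `↥A` has a neighbourhood on which `δι` has finite `ν`-integral — road bricks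
(CO) + (HT) + D3c, hypothesis-until-★), for every REGULAR `X₀ : ↥𝔲₀`:  `∃ U ∈ 𝓝 X₀, ∫⁻ X in U, ηι ↑X ∂μ < ∞`.

## Proof (chain of WORDS #6)
LH1-p03 FILE 3 (ambient strict derivative of `χ′ = (tr ∘ adj, det)` at `↑X₀`, R1 norms) unfolded to the `ε–δ` estimate → ★ D2♭ `exists_newtonData_submersion_addSubgroup`
with `S := 𝔲₀`, `A`, `P := χ′`, `L :=` the differential, `hPS ∕ hLS` from ★ D4a FILE 2 (`sigma_trace_adjugate_of_mem`, `sigma_det_of_mem`, `trace_mul_theta`,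
`trace_adjugate_mul_theta`), the bounded additive SECTION `t (c, d) := c • Y_c + (d·λ⁻¹) • Y_d` from FILE 2 `exists_mem_trace_zero_differential_eq_of_linearIndependent`
at `(1, 0)` and `(0, λ)` → ★ FILE 2′ `depth_chart_of_newtonData` on `↥𝔲₀` (linearisation of `∫⁻` on deep balls) → (C0) additive submersion bound along D2♭'s
`E : ↥𝔲₀ ≃ₜ+ ↥A × ker` → depth so that `fst (E (Λ_k))` sits inside the `hcusp`-neighbourhood of `χ′ X₀` → translations on `↥A` and `↥𝔲₀`
(`MeasurePreserving.setLIntegral_comp_emb`) — the scalar-free twin of ★ FILE A `F0P3cStCharTSSubmersionPullback`. [HarishChandra1970 Part VII §1 Thm. 15 (regular set);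
Schikhof1984 §27; DeitmarEchterhoff2014 Thm. 1.5.3]
-/

set_option autoImplicit false
-- the mandated namespace has the single-problem summit's repeated segment (`HodgeConjecture.HodgeConjecture`)
set_option linter.dupNamespace false

noncomputable section



open MeasureTheory Filter Metric Set Topology Matrix
open scoped ENNReal NNReal Pointwise
open Literature.NumberTheory.GaloisRepresentations Literature.NumberTheory.GaloisRepresentations.IsNonarchimedeanLocalField
open Literature.MeasureTheory.Group Literature.Analysis.Calculus
open Summit.HodgeConjecture.HodgeConjecture.Cruxes.H413.F0P3cStCharTSSubmersionDescent
open Summit.HodgeConjecture.HodgeConjecture.Cruxes.H413.F0P3cStCharTSNewtonCore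
open Summit.HodgeConjecture.HodgeConjecture.Cruxes.H413.F0P3cStCharTSChevalleyDifferential

namespace Summit.HodgeConjecture.HodgeConjecture.Cruxes.H413.F0P3cStCharTSHCDRegularPoints


/-! ## §1 Algebra over a field: `θ s = s` on `𝔲`, the `σ`-pattern of the differential on `𝔲`, scalar closure, the trace-zero discriminant -/

section Algebra

variable {K : Type*} [Field K] (σ : K →+* K) {J : Matrix (Fin 3) (Fin 3) K} (hJ : IsUnit J.det)
include hJ

/-- For skew-hermitian `s` the involution `θ Y = −J⁻¹ (Y.map σ)ᵀ J` fixes `s`. [cite: Rogawski1990, §1.9 p. 8] -/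
theorem theta_eq_self_of_mem {s : Matrix (Fin 3) (Fin 3) K} (hs : (s.map σ)ᵀ * J + J * s = 0) :
    -(J⁻¹ * (s.map σ)ᵀ * J) = s := by
  rw [map_transpose_eq_of_mem σ hJ hs]
  have h1 : J⁻¹ * J = 1 := Matrix.nonsing_inv_mul J hJ
  calc -(J⁻¹ * -(J * s * J⁻¹) * J) = (J⁻¹ * J) * s * (J⁻¹ * J) := by noncomm_ring
    _ = s := by rw [h1, one_mul, mul_one]

/-- `σ (tr (X s)) = tr (X s)` for skew-hermitian `X`, `s`. [cite: Rogawski1990, §1.9 p. 8] -/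
theorem sigma_trace_mul_of_mem {X s : Matrix (Fin 3) (Fin 3) K} (hX : (X.map σ)ᵀ * J + J * X = 0) (hs : (s.map σ)ᵀ * J + J * s = 0) :
    σ (trace (X * s)) = trace (X * s) := by
  have h := trace_mul_theta σ hJ hX s
  rw [theta_eq_self_of_mem σ hJ hs] at h
  exact h.symm

/-- `σ (tr (adj X · s)) = −tr (adj X · s)` for skew-hermitian `X`, `s`. [cite: Rogawski1990, §1.9 p. 8] -/
theorem sigma_trace_adjugate_mul_of_mem {X s : Matrix (Fin 3) (Fin 3) K} (hX : (X.map σ)ᵀ * J + J * X = 0)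
    (hs : (s.map σ)ᵀ * J + J * s = 0) : σ (trace (adjugate X * s)) = -trace (adjugate X * s) := by
  have h := trace_adjugate_mul_theta σ hJ hX s
  rw [theta_eq_self_of_mem σ hJ hs] at h
  calc σ (trace (adjugate X * s)) = -(-σ (trace (adjugate X * s))) := (neg_neg _).symm
    _ = -trace (adjugate X * s) := by rw [← h]

omit hJ in
/-- `σ`-fixed scalars preserve skew-hermitian matrices. [cite: Rogawski1990, §1.9 p. 8] -/
theorem skew_smul_of_fixed {c : K} (hc : σ c = c) {Y : Matrix (Fin 3) (Fin 3) K} (hY : (Y.map σ)ᵀ * J + J * Y = 0) :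
    ((c • Y).map σ)ᵀ * J + J * (c • Y) = 0 := by
  have hmap : (c • Y).map σ = σ c • Y.map σ := by
    ext i j; simp
  rw [hmap, hc, transpose_smul, Matrix.smul_mul, Matrix.mul_smul, ← smul_add, hY, smul_zero]

omit hJ in
/-- **Trace-zero discriminant**: `discr (charpoly Y) = −4 (tr adj Y)³ − 27 (det Y)²` when `tr Y = 0`. [cite: HornJohnson2013, §1.2 Problem 1.2.P18] -/
theorem discr_charpoly_of_trace_eq_zero (Y : Matrix (Fin 3) (Fin 3) K) (hY : trace Y = 0) :
    (Matrix.charpoly Y).discr = -4 * trace (adjugate Y) ^ 3 - 27 * det Y ^ 2 := by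
  have hc : Y.charpoly = Polynomial.X ^ 3 + Polynomial.C (-Y.trace) * Polynomial.X ^ 2 + Polynomial.C (Y.adjugate.trace) * Polynomial.X
      + Polynomial.C (-Y.det) := by
    rw [Literature.LinearAlgebra.Matrix.CharpolyBlockPatterns.charpoly_fin_three_trace_adjugate, Polynomial.C_neg, Polynomial.C_neg]
    ring
  have h := Literature.LinearAlgebra.Matrix.discr_eq_of_charpoly_eq hc
  rw [show (Matrix.charpoly Y).discr = Matrix.discr Y from rfl, h, hY]
  ring

end Algebra

/-! ## §2 The strict estimate, unfolded -/

/-- `HasStrictFDerivAt` as an `ε–δ` estimate `‖f p − f q − f′ (p − q)‖ ≤ ε ‖p − q‖` near `x` (the input shape of ★ D2♭). [cite: Schikhof1984, §27 Thm. 27.5] -/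
theorem strictEstimate_of_hasStrictFDerivAt {𝕜 : Type*} [NontriviallyNormedField 𝕜] {E : Type*} [NormedAddCommGroup E] [NormedSpace 𝕜 E]
    {F : Type*} [NormedAddCommGroup F] [NormedSpace 𝕜 F] {f : E → F} {f' : E →L[𝕜] F} {x : E} (h : HasStrictFDerivAt f f' x) :
    ∀ ε > 0, ∃ δ > 0, ∀ p q : E, ‖p - x‖ < δ → ‖q - x‖ < δ → ‖f p - f q - f' (p - q)‖ ≤ ε * ‖p - q‖ := by
  intro ε hε
  have hlo := (hasStrictFDerivAt_iff_isLittleO.1 h).def hε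
  obtain ⟨δ, hδ, hball⟩ := Metric.eventually_nhds_iff.1 hlo
  refine ⟨δ, hδ, fun p q hp hq => ?_⟩
  have hpq : dist (p, q) (x, x) < δ := by
    rw [Prod.dist_eq, dist_eq_norm, dist_eq_norm]
    exact max_lt hp hq
  exact hball hpq

/-! ## §3 The regular-point theorem -/

/-- **D5(i) «REGULAR POINTS ON `↥𝔲₀`».**  In the road's scalar-free frame (module docstring): if the cusp integrand
`δι (c, d) = (↑√√|−4c³ − 27d²|_K)⁻¹` has finite `ν`-integral near every point of the coefficient group `↥A` (`hcusp`, road bricks (CO)+(HT)+D3c), then for every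
REGULAR `X₀ : ↥𝔲₀` (`1, X₀, X₀²` independent) the Weyl-discriminant integrand `ηι X = (↑√√|discr (charpoly X)|_K)⁻¹` has finite `μ`-integral on a neighbourhood of `X₀`
in `↥𝔲₀`.  Proof: LH1-p03 FILE 3 → ★ D2♭ → ★ FILE 2′ → (C0) → translations (see module docstring).
[cite: HarishChandra1970, Part VII §1 Thm. 15] [cite: Schikhof1984, §27 Lemma 27.4–Thm. 27.5] [cite: DeitmarEchterhoff2014, Thm. 1.5.3] -/
theorem exists_nhds_setLIntegral_etaIota_lt_top
    {K : Type*} [Field K] [ValuativeRel K] [TopologicalSpace K] [IsNonarchimedeanLocalField K]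
    (σ : K →+* K) (hσ : ∀ x, σ (σ x) = x) {J : Matrix (Fin 3) (Fin 3) K} (hJσ : (J.map σ)ᵀ = J) (hJ : IsUnit J.det)
    (h2 : (2 : K) ≠ 0) (lam : Kˣ) (hlam : σ (lam : K) = -(lam : K))
    (𝔲₀ : AddSubgroup (Matrix (Fin 3) (Fin 3) K)) (h𝔲₀ : ∀ X, X ∈ 𝔲₀ ↔ (X.map σ)ᵀ * J + J * X = 0 ∧ trace X = 0)
    (h𝔲₀c : IsClosed (𝔲₀ : Set (Matrix (Fin 3) (Fin 3) K)))
    [MeasurableSpace ↥𝔲₀] [BorelSpace ↥𝔲₀] (μ : Measure ↥𝔲₀) [μ.IsAddHaarMeasure]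
    (A : AddSubgroup (K × K)) (hA : ∀ p : K × K, p ∈ A ↔ σ p.1 = p.1 ∧ σ p.2 = -p.2) (hAc : IsClosed (A : Set (K × K)))
    [MeasurableSpace ↥A] [BorelSpace ↥A] (ν : Measure ↥A) [ν.IsAddHaarMeasure]
    (hcusp : ∀ a₀ : ↥A, ∃ W ∈ 𝓝 a₀, ∫⁻ a in W,
      ((NNReal.sqrt (NNReal.sqrt (normAbs K (-4 * (a : K × K).1 ^ 3 - 27 * (a : K × K).2 ^ 2))) : ℝ≥0∞))⁻¹ ∂ν < ∞)
    (X₀ : ↥𝔲₀) (hreg : LinearIndependent K ![(1 : Matrix (Fin 3) (Fin 3) K), (X₀ : Matrix (Fin 3) (Fin 3) K), (X₀ : Matrix (Fin 3) (Fin 3) K) ^ 2]) :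
    ∃ U ∈ 𝓝 X₀, ∫⁻ X in U, ((NNReal.sqrt (NNReal.sqrt (normAbs K (Matrix.charpoly (X : Matrix (Fin 3) (Fin 3) K)).discr)) : ℝ≥0∞))⁻¹ ∂μ < ∞ := by
  classical
  -- ===== R1 frame, inside the proof only =====
  letI : NontriviallyNormedField K := IsNonarchimedeanLocalField.nontriviallyNormedField K
  haveI : CompleteSpace K := IsNonarchimedeanLocalField.completeSpace_nontriviallyNormedField K
  haveI : IsUltrametricDist K := IsNonarchimedeanLocalField.isUltrametricDist_nontriviallyNormedField K
  haveI : ProperSpace K := ProperSpace.of_nontriviallyNormedField_of_weaklyLocallyCompactSpace K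
  haveI : SecondCountableTopology K := secondCountable_of_proper
  haveI : SecondCountableTopology (Matrix (Fin 3) (Fin 3) K) := inferInstanceAs (SecondCountableTopology (Fin 3 → Fin 3 → K))
  letI : NormedAddCommGroup (Matrix (Fin 3) (Fin 3) K) := Matrix.normedAddCommGroup
  letI : NormedSpace K (Matrix (Fin 3) (Fin 3) K) := Matrix.normedSpace
  haveI : IsUltrametricDist (Matrix (Fin 3) (Fin 3) K) := inferInstanceAs (IsUltrametricDist (Fin 3 → Fin 3 → K))
  haveI : ProperSpace (Matrix (Fin 3) (Fin 3) K) := inferInstanceAs (ProperSpace (Fin 3 → Fin 3 → K))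
  haveI : Invertible (2 : K) := invertibleOfNonzero h2
  haveI : ProperSpace ↥𝔲₀ := ProperSpace.of_isClosed h𝔲₀c
  haveI : LocallyCompactSpace (Matrix (Fin 3) (Fin 3) K) := inferInstanceAs (LocallyCompactSpace (Fin 3 → Fin 3 → K))
  haveI : LocallyCompactSpace ↥𝔲₀ := h𝔲₀c.isClosedEmbedding_subtypeVal.locallyCompactSpace
  haveI : LocallyCompactSpace ↥A := hAc.isClosedEmbedding_subtypeVal.locallyCompactSpace
  -- ===== the data at `X₀` =====
  have hX₀ : ((X₀ : Matrix (Fin 3) (Fin 3) K).map σ)ᵀ * J + J * (X₀ : Matrix (Fin 3) (Fin 3) K) = 0 ∧ trace (X₀ : Matrix (Fin 3) (Fin 3) K) = 0 :=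
    (h𝔲₀ _).1 X₀.2
  have hmem : ∀ s : ↥𝔲₀, ((s : Matrix (Fin 3) (Fin 3) K).map σ)ᵀ * J + J * (s : Matrix (Fin 3) (Fin 3) K) = 0 ∧ trace (s : Matrix (Fin 3) (Fin 3) K) = 0 :=
    fun s => (h𝔲₀ _).1 s.2
  -- ===== `P = (tr ∘ adj, det)` and its strict differential (FILE 3) =====
  obtain ⟨L₂, hL₂, hd₂⟩ := Literature.LinearAlgebra.Matrix.CubicChevalleyStrictDeriv.hasStrictFDerivAt_trace_adjugate (X₀ : Matrix (Fin 3) (Fin 3) K)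
  obtain ⟨L₃, hL₃, hd₃⟩ := Literature.LinearAlgebra.Matrix.CubicChevalleyStrictDeriv.hasStrictFDerivAt_det (X₀ : Matrix (Fin 3) (Fin 3) K)
  set P : Matrix (Fin 3) (Fin 3) K → K × K := fun Y => (trace (adjugate Y), det Y) with hPdef
  set L' : Matrix (Fin 3) (Fin 3) K →L[K] K × K := L₂.prod L₃ with hL'def
  have hL' : ∀ Y, L' Y = (trace (X₀ : Matrix (Fin 3) (Fin 3) K) * trace Y - trace ((X₀ : Matrix (Fin 3) (Fin 3) K) * Y),
      trace (adjugate (X₀ : Matrix (Fin 3) (Fin 3) K) * Y)) := fun Y => by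
    simp only [hL'def, ContinuousLinearMap.prod_apply, hL₂, hL₃]
  have hPd : HasStrictFDerivAt P L' (X₀ : Matrix (Fin 3) (Fin 3) K) := hd₂.prodMk hd₃
  set L : Matrix (Fin 3) (Fin 3) K →+ K × K := (L' : Matrix (Fin 3) (Fin 3) K →ₗ[K] K × K).toAddMonoidHom with hLdef
  have hLL : ∀ Y, L Y = L' Y := fun Y => rfl
  -- the `ε–δ` strict estimate
  have hP := strictEstimate_of_hasStrictFDerivAt hPd
  -- ===== `P` and `L` map `𝔲₀` into the coefficient group `A` =====
  have hPA : ∀ Y : Matrix (Fin 3) (Fin 3) K, (Y.map σ)ᵀ * J + J * Y = 0 → P Y ∈ A := fun Y hY =>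
    (hA _).2 ⟨sigma_trace_adjugate_of_mem σ hJ hY, sigma_det_of_mem σ hJ hY⟩
  have hPS : ∀ s : ↥𝔲₀, P ((X₀ : Matrix (Fin 3) (Fin 3) K) + s) - P X₀ ∈ A :=
    fun s => A.sub_mem (hPA _ ((h𝔲₀ _).1 (𝔲₀.add_mem X₀.2 s.2)).1) (hPA _ hX₀.1)
  have hLS : ∀ s : ↥𝔲₀, L (s : Matrix (Fin 3) (Fin 3) K) ∈ A := by
    intro s
    rw [hLL, hL', (hmem s).2, mul_zero, zero_sub]
    refine (hA _).2 ⟨?_, ?_⟩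
    · rw [map_neg, sigma_trace_mul_of_mem σ hJ hX₀.1 (hmem s).1]
    · exact sigma_trace_adjugate_mul_of_mem σ hJ hX₀.1 (hmem s).1
  -- ===== the bounded additive section `t (c, d) = c • Y₁ + (d·λ⁻¹) • Y₂` =====
  obtain ⟨Y₁, hY₁s, hY₁t, hY₁c, hY₁d⟩ := exists_mem_trace_zero_differential_eq_of_linearIndependent σ hσ hJσ hJ hX₀.1 hreg
    1 0 (map_one σ) (by rw [map_zero, neg_zero])
  obtain ⟨Y₂, hY₂s, hY₂t, hY₂c, hY₂d⟩ := exists_mem_trace_zero_differential_eq_of_linearIndependent σ hσ hJσ hJ hX₀.1 hreg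
    0 (lam : K) (map_zero σ) hlam
  have hlam0 : (lam : K) ≠ 0 := lam.ne_zero
  have hfix : ∀ a : ↥A, σ ((a : K × K).2 * (lam : K)⁻¹) = (a : K × K).2 * (lam : K)⁻¹ := by
    intro a
    rw [map_mul, map_inv₀, ((hA _).1 a.2).2, hlam, inv_neg, neg_mul_neg]
  have htmem : ∀ a : ↥A, (a : K × K).1 • Y₁ + ((a : K × K).2 * (lam : K)⁻¹) • Y₂ ∈ 𝔲₀ := by
    intro a
    refine 𝔲₀.add_mem ((h𝔲₀ _).2 ⟨skew_smul_of_fixed σ ((hA _).1 a.2).1 hY₁s, ?_⟩) ((h𝔲₀ _).2 ⟨skew_smul_of_fixed σ (hfix a) hY₂s, ?_⟩)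
    · rw [trace_smul, hY₁t, smul_zero]
    · rw [trace_smul, hY₂t, smul_zero]
  set t : ↥A → ↥𝔲₀ := fun a => ⟨(a : K × K).1 • Y₁ + ((a : K × K).2 * (lam : K)⁻¹) • Y₂, htmem a⟩ with htdef
  have htcoe : ∀ a : ↥A, ((t a : ↥𝔲₀) : Matrix (Fin 3) (Fin 3) K) = (a : K × K).1 • Y₁ + ((a : K × K).2 * (lam : K)⁻¹) • Y₂ := fun a => rfl
  have ht : ∀ a b, t (a + b) = t a + t b := by
    intro a b
    apply Subtype.ext
    simp only [AddSubgroup.coe_add, htcoe, Prod.fst_add, Prod.snd_add, add_smul, add_mul]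
    abel
  have hLt : ∀ a : ↥A, L ((t a : ↥𝔲₀) : Matrix (Fin 3) (Fin 3) K) = (a : K × K) := by
    intro a
    rw [htcoe, map_add, hLL, hLL, map_smul, map_smul, hL', hL', hY₁c, hY₁d, hY₂c, hY₂d]
    ext <;> simp [hlam0]
  have hC : ∀ a : ↥A, ‖((t a : ↥𝔲₀) : Matrix (Fin 3) (Fin 3) K)‖ ≤ (‖Y₁‖ + ‖(lam : K)⁻¹‖ * ‖Y₂‖) * ‖(a : K × K)‖ := by
    intro a
    rw [htcoe]
    have h1 : ‖(a : K × K).1‖ ≤ ‖(a : K × K)‖ := norm_fst_le _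
    have h2 : ‖(a : K × K).2‖ ≤ ‖(a : K × K)‖ := norm_snd_le _
    calc ‖(a : K × K).1 • Y₁ + ((a : K × K).2 * (lam : K)⁻¹) • Y₂‖
        ≤ ‖(a : K × K).1 • Y₁‖ + ‖((a : K × K).2 * (lam : K)⁻¹) • Y₂‖ := norm_add_le _ _
      _ = ‖(a : K × K).1‖ * ‖Y₁‖ + ‖(a : K × K).2‖ * ‖(lam : K)⁻¹‖ * ‖Y₂‖ := by rw [norm_smul, norm_smul, norm_mul]
      _ ≤ ‖(a : K × K)‖ * ‖Y₁‖ + ‖(a : K × K)‖ * ‖(lam : K)⁻¹‖ * ‖Y₂‖ := by gcongr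
      _ = (‖Y₁‖ + ‖(lam : K)⁻¹‖ * ‖Y₂‖) * ‖(a : K × K)‖ := by ring
  -- ===== D2♭: Newton data on `↥𝔲₀` =====
  obtain ⟨E, Ψ, hE1, hE2, hEsymm, hΨ1, hΨ2, hΨ0, hN⟩ :=
    exists_newtonData_submersion_addSubgroup 𝔲₀ A P L L'.continuous (X₀ : Matrix (Fin 3) (Fin 3) K) hP hPS hLS t ht hLt hC
  -- ===== FILE 2′: the chart on deep balls of `↥𝔲₀` =====
  letI : MeasurableSpace ↥(L.comp 𝔲₀.subtype).ker := borel _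
  haveI : BorelSpace ↥(L.comp 𝔲₀.subtype).ker := ⟨rfl⟩
  obtain ⟨Λ, hΛ⟩ := exists_addSubgroup_coe_eq_closedBall (V := ↥𝔲₀) one_pos (by norm_num : (0 : ℝ) < 1 / 2)
  obtain ⟨k₀, hk₀⟩ := hN one_pos (by norm_num : (0 : ℝ) < 1 / 2) (by norm_num : (1 / 2 : ℝ) < 1)
  -- Borel instances for the normed (defeq) topologies, passed explicitly
  have hBW : BorelSpace (↥A × ↥(L.comp 𝔲₀.subtype).ker) :=
    @Prod.borelSpace ↥A ↥(L.comp 𝔲₀.subtype).ker _ _ ‹BorelSpace ↥A› _ _ ‹BorelSpace ↥(L.comp 𝔲₀.subtype).ker› _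
  have hchart := @depth_chart_of_newtonData ↥𝔲₀ _ _ _ _ ‹BorelSpace ↥𝔲₀› (↥A × ↥(L.comp 𝔲₀.subtype).ker) _ _ hBW
    μ ‹μ.IsAddHaarMeasure›.toIsFiniteMeasureOnCompacts ‹μ.IsAddHaarMeasure›.toIsAddLeftInvariant _ _ E _ _ _ hΛ one_pos
    (by norm_num : (0 : ℝ) < 1 / 2) (by norm_num : (1 / 2 : ℝ) < 1) _ hk₀
  -- ===== the kernel is a closed subgroup, hence locally compact =====
  have hkerc : IsClosed (((L.comp 𝔲₀.subtype).ker : AddSubgroup ↥𝔲₀) : Set ↥𝔲₀) := by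
    have hc : Continuous fun s : ↥𝔲₀ => L' (s : Matrix (Fin 3) (Fin 3) K) := L'.continuous.comp continuous_subtype_val
    have hset : (((L.comp 𝔲₀.subtype).ker : AddSubgroup ↥𝔲₀) : Set ↥𝔲₀) = (fun s : ↥𝔲₀ => L' (s : Matrix (Fin 3) (Fin 3) K)) ⁻¹' {0} := by
      ext s; simp [AddMonoidHom.mem_ker, hLL]
    rw [hset]; exact isClosed_singleton.preimage hc
  have hkerlc : LocallyCompactSpace ↥(L.comp 𝔲₀.subtype).ker := hkerc.isClosedEmbedding_subtypeVal.locallyCompactSpace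
  -- ===== the cusp integrand on `↥A`, its measurability, the base point =====
  set Δ' : K × K → ℝ≥0∞ := fun p => ((NNReal.sqrt (NNReal.sqrt (normAbs K (-4 * p.1 ^ 3 - 27 * p.2 ^ 2))) : ℝ≥0∞))⁻¹ with hΔ'
  have hΔ'c : Continuous fun p : K × K => NNReal.sqrt (NNReal.sqrt (normAbs K (-4 * p.1 ^ 3 - 27 * p.2 ^ 2))) := by
    have hpoly : Continuous fun p : K × K => (-4 * p.1 ^ 3 - 27 * p.2 ^ 2 : K) :=
      ((continuous_const.mul (continuous_fst.pow 3)).sub (continuous_const.mul (continuous_snd.pow 2)))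
    exact NNReal.continuous_sqrt.comp (NNReal.continuous_sqrt.comp
      (Literature.NumberTheory.Automorphic.LocalFieldHaar.continuous_normAbs.comp hpoly))
  set Δ : ↥A → ℝ≥0∞ := fun a => Δ' (a : K × K) with hΔ
  have hΔm : Measurable Δ :=
    ((ENNReal.continuous_coe.comp (hΔ'c.comp continuous_subtype_val)).measurable).inv
  have ha₀A : P (X₀ : Matrix (Fin 3) (Fin 3) K) ∈ A := hPA _ hX₀.1
  set a₀ : ↥A := ⟨P (X₀ : Matrix (Fin 3) (Fin 3) K), ha₀A⟩ with ha₀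
  obtain ⟨W, hW, hWfin⟩ := hcusp a₀
  set g : ↥A → ℝ≥0∞ := fun a => Δ (a₀ + a) with hg
  have hgm : Measurable g := hΔm.comp (measurable_const_add a₀)
  -- ===== depth: `fst (E (Λ k))` inside the translated cusp neighbourhood =====
  have hV₀ : (fun a : ↥A => a₀ + a) ⁻¹' W ∈ 𝓝 (0 : ↥A) := by
    have hc : Continuous fun a : ↥A => a₀ + a := continuous_const.add continuous_id
    refine hc.continuousAt.preimage_mem_nhds ?_
    rw [add_zero]; exact hW
  have hE0 : (fun s : ↥𝔲₀ => (E s).1) ⁻¹' ((fun a : ↥A => a₀ + a) ⁻¹' W) ∈ 𝓝 (0 : ↥𝔲₀) := by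
    have hc : Continuous fun s : ↥𝔲₀ => (E s).1 := continuous_fst.comp E.continuous
    refine hc.continuousAt.preimage_mem_nhds ?_
    rw [map_zero, Prod.fst_zero]; exact hV₀
  obtain ⟨k₁, hk₁⟩ := exists_subset_of_mem_nhds_of_coe_eq_closedBall hΛ one_pos (by norm_num : (1 / 2 : ℝ) < 1) _ hE0
  set k := max k₀ k₁ with hk
  obtain ⟨-, -, -, hint⟩ := hchart k (le_max_left _ _)
  have hΛsub : (Λ k : Set ↥𝔲₀) ⊆ (fun s : ↥𝔲₀ => (E s).1) ⁻¹' ((fun a : ↥A => a₀ + a) ⁻¹' W) :=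
    (SetLike.coe_subset_coe.2 (antitone_of_coe_eq_closedBall hΛ zero_le_one (by norm_num) (by norm_num) (le_max_right k₀ k₁))).trans hk₁
  -- ===== (C0) on the compact ball `Λ k` =====
  haveI hsc𝔲 : SecondCountableTopology ↥𝔲₀ := TopologicalSpace.Subtype.secondCountableTopology _
  haveI hscker : SecondCountableTopology ↥(L.comp 𝔲₀.subtype).ker := TopologicalSpace.Subtype.secondCountableTopology _
  obtain ⟨C₀, hC₀, hbound⟩ := @exists_setLIntegral_fst_le_of_continuousAddEquiv ↥𝔲₀ ↥A ↥(L.comp 𝔲₀.subtype).ker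
    _ _ _ _ ‹BorelSpace ↥𝔲₀› _ _ _ ‹LocallyCompactSpace ↥A› _ _ ‹BorelSpace ↥A› _ _ _ hkerlc hscker _ ‹BorelSpace ↥(L.comp 𝔲₀.subtype).ker›
    E μ ‹μ.IsAddHaarMeasure› ν ‹ν.IsAddHaarMeasure› _ (isCompact_of_coe_eq_closedBall hΛ k)
  -- ===== the neighbourhood `U = X₀ + Λ k` =====
  have hΛk0 : (Λ k : Set ↥𝔲₀) ∈ 𝓝 (0 : ↥𝔲₀) := by
    rw [hΛ]; exact closedBall_mem_nhds _ (by positivity)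
  refine ⟨(fun v : ↥𝔲₀ => X₀ + v) '' (Λ k : Set ↥𝔲₀), ?_, ?_⟩
  · have h := (Homeomorph.addLeft X₀).isOpenMap.image_mem_nhds hΛk0
    simpa using h
  -- ===== the chain of (in)equalities =====
  have hη : (fun X : ↥𝔲₀ => ((NNReal.sqrt (NNReal.sqrt (normAbs K (Matrix.charpoly (X : Matrix (Fin 3) (Fin 3) K)).discr)) : ℝ≥0∞))⁻¹)
      = fun X : ↥𝔲₀ => Δ' (P (X : Matrix (Fin 3) (Fin 3) K)) := by
    funext X
    simp only [hΔ', hPdef, discr_charpoly_of_trace_eq_zero _ (hmem X).2]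
  rw [hη]
  -- translate `μ`
  have e1 : ∫⁻ v in (Λ k : Set ↥𝔲₀), Δ' (P ((X₀ + v : ↥𝔲₀) : Matrix (Fin 3) (Fin 3) K)) ∂μ
      = ∫⁻ X in (fun v : ↥𝔲₀ => X₀ + v) '' (Λ k : Set ↥𝔲₀), Δ' (P (X : Matrix (Fin 3) (Fin 3) K)) ∂μ :=
    (measurePreserving_add_left μ X₀).setLIntegral_comp_emb (MeasurableEquiv.addLeft X₀).measurableEmbedding
      (fun X : ↥𝔲₀ => Δ' (P (X : Matrix (Fin 3) (Fin 3) K))) _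
  rw [← e1]
  -- the chart: `Δ' (P (X₀ + v)) = f (Ψ v)` with `f w = g w.1`
  set f : ↥A × ↥(L.comp 𝔲₀.subtype).ker → ℝ≥0∞ := fun w => g w.1 with hf
  have hfm : Measurable f := hgm.comp measurable_fst
  have e2 : (fun v : ↥𝔲₀ => Δ' (P ((X₀ + v : ↥𝔲₀) : Matrix (Fin 3) (Fin 3) K))) = fun v => f (Ψ (0 + v)) := by
    funext v
    simp only [hf, hg, hΔ, ha₀, zero_add, AddSubgroup.coe_add, hΨ1, add_sub_cancel]
  rw [e2, hint f hfm, hΨ0]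
  have e3 : (fun v : ↥𝔲₀ => f (0 + E v)) = fun v => g (E v).1 := by
    funext v; simp only [hf, zero_add]
  rw [e3]
  refine lt_of_le_of_lt (hbound g hgm) (ENNReal.mul_lt_top hC₀ ?_)
  -- translate `ν` and enlarge to `W`
  have e4 : ∫⁻ a in Prod.fst '' ((E : ↥𝔲₀ → ↥A × ↥(L.comp 𝔲₀.subtype).ker) '' (Λ k : Set ↥𝔲₀)), g a ∂ν
      = ∫⁻ b in (fun a : ↥A => a₀ + a) '' (Prod.fst '' ((E : ↥𝔲₀ → ↥A × ↥(L.comp 𝔲₀.subtype).ker) '' (Λ k : Set ↥𝔲₀))), Δ b ∂ν :=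
    (measurePreserving_add_left ν a₀).setLIntegral_comp_emb (MeasurableEquiv.addLeft a₀).measurableEmbedding Δ _
  have hsub : (fun a : ↥A => a₀ + a) '' (Prod.fst '' ((E : ↥𝔲₀ → ↥A × ↥(L.comp 𝔲₀.subtype).ker) '' (Λ k : Set ↥𝔲₀))) ⊆ W := by
    rintro _ ⟨a, ⟨w, ⟨s, hs, rfl⟩, rfl⟩, rfl⟩
    exact hΛsub hs
  exact lt_of_le_of_lt ((le_of_eq e4).trans (lintegral_mono_set hsub)) hWfin


end Summit.HodgeConjecture.HodgeConjecture.Cruxes.H413.F0P3cStCharTSHCDRegularPoints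

end
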